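import Literature.Combinatorics.SimpleGraph.OrderedRefinementStable
import HarnessLib

/-!
# Colour refinement from an arbitrary start computes the COARSEST equitable refinement

Companion to `OrderedRefinementStable.lean` (which proves that the rounds `ocrIter G col t` of ordered colour
refinement started from an arbitrary colouring `col` stabilise and are then equitable). Here the universal
property: **every equitable colouring finer than `col` is finer than every round** — McKay–Piperno's
"`R(G, π, α)` is the coarsest equitable colouring finer than `π`" [MckayPiperno2014, §2.3], the form in which
individualisation–refinement arguments (Corneil–Goldberg recursion trees, nauty/Traces) use colour refinement
restarted from a refined colouring. The uniform-start case is `IsEquitable.crRel_of_eq` in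
`ColourRefinement.lean`; the proof is the same one-step count decomposition along the classes of the finer
colouring (`IsEquitable.ocrStep_eq_of_finer`), iterated (`IsEquitable.ocrIter_eq_of_finer`).

## References

* B. D. McKay, A. Piperno, *Practical graph isomorphism II*, J. Symb. Comput. 60 (2014) 94–112, §2.3
  (refinement: "the coarsest equitable colouring finer than π"). [MckayPiperno2014]
* S. Kiefer, B. D. McKay, *The iteration number of colour refinement*, ICALP 2020, §2. [KieferMcKay2020]
-/

namespace Literature.Combinatorics.SimpleGraph

open _root_.SimpleGraph Finset

universe u

variable {V : Type u} [Fintype V] {G : _root_.SimpleGraph V} [DecidableRel G.Adj]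

/-! ## Coarsest: every equitable refinement of the start refines every round -/

/-- **One step does not split the classes of an equitable refinement of `col`.** If `c'` is equitable
and refines `col`, then `c'` refines `ocrStep G col`: two `c'`-equivalent vertices have the same colour
and, for every colour `cc` of `col`, the same number of neighbours of colour `cc` — the `cc`-class is a
union of `c'`-classes, on each of which the counts agree. [cite: MckayPiperno2014, §2.3 (the refinement is the coarsest equitable colouring finer than the start)] -/
theorem IsEquitable.ocrStep_eq_of_finer {κ' : Type*} {col : V → ℕ} {c' : V → κ'} (hc' : IsEquitable G c')
    (hfin : ∀ u v : V, c' u = c' v → col u = col v) {u v : V} (huv : c' u = c' v) :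
    ocrStep G col u = ocrStep G col v := by
  classical
  rw [ocrStep_eq_iff]
  refine ⟨hfin u v huv, fun w => ?_⟩
  -- decompose the `cc`-count of any vertex along the `c'`-classes
  have hdec : ∀ x : V, nbrCount G col x (col w) =
      ∑ y ∈ univ.image c', ((univ.filter fun z => G.Adj x z ∧ col z = col w).filter fun z => c' z = y).card :=
    fun x => card_eq_sum_card_fiberwise fun z _ => mem_image_of_mem c' (mem_univ z)
  rw [hdec u, hdec v]
  refine sum_congr rfl fun y hy => ?_
  obtain ⟨x₀, -, rfl⟩ := mem_image.1 hy
  by_cases hx₀ : col x₀ = col w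
  · -- the whole `c'`-class of `x₀` lies in the `col w`-class: the terms are the `c'`-counts
    have hfilt : ∀ x : V, ((univ.filter fun z => G.Adj x z ∧ col z = col w).filter fun z => c' z = c' x₀) =
        univ.filter fun z => G.Adj x z ∧ c' z = c' x₀ := by
      intro x
      ext z
      simp only [mem_filter, mem_univ, true_and]
      exact ⟨fun h => ⟨h.1.1, h.2⟩, fun h => ⟨⟨h.1, (hfin z x₀ h.2).trans hx₀⟩, h.2⟩⟩
    rw [hfilt u, hfilt v, ← natCard_subtype_eq_card_filter', ← natCard_subtype_eq_card_filter']
    exact hc' u v huv (c' x₀)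
  · -- the `c'`-class of `x₀` misses the `col w`-class: both terms vanish
    have hfilt : ∀ x : V, ((univ.filter fun z => G.Adj x z ∧ col z = col w).filter fun z => c' z = c' x₀) = ∅ := by
      intro x
      rw [filter_eq_empty_iff]
      intro z hz hzc
      rw [mem_filter] at hz
      exact hx₀ ((hfin z x₀ hzc).symm.trans hz.2.2)
    rw [hfilt u, hfilt v]

/-- **Ordered colour refinement from `col` is the COARSEST equitable refinement of `col`**: every
equitable colouring finer than `col` is finer than every round `ocrIter G col t` (and round `|V| - 1` is
itself equitable, `isEquitable_ocrIter`). [cite: MckayPiperno2014, §2.3] [cite: KieferMcKay2020, §2] -/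
theorem IsEquitable.ocrIter_eq_of_finer {κ' : Type*} {col : V → ℕ} {c' : V → κ'} (hc' : IsEquitable G c')
    (hfin : ∀ u v : V, c' u = c' v → col u = col v) (t : ℕ) {u v : V} (huv : c' u = c' v) :
    ocrIter G col t u = ocrIter G col t v := by
  induction t generalizing u v with
  | zero => exact hfin u v huv
  | succ t ih =>
    rw [ocrIter_succ]
    exact hc'.ocrStep_eq_of_finer (fun a b hab => ih hab) huv

end Literature.Combinatorics.SimpleGraph
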